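import Summits.BirchSwinnertonDyer.BirchSwinnertonDyer.Theorems.EdixhovenFibreFiveSevenStarredOptimalManinUnitFiveSevenAssemblySocket
import Literature.NumberTheory.EllipticCurves.CuspFormLFunctionLevelConductorProofs
import HarnessLib

/-!
# F″ programme, CARAYOL-FREE right end: F″ ⟸ NIV and F″ ⟸ H / H′ with NO «level = conductor» hypothesis
# (route `EdixhovenFibreFiveSeven`, crux K★ `StarredOptimalManinUnitFiveSeven`, stmt-BirchSwinnertonDyer-22226,
# line `kato-lever`; `--supports` 22226, helper)

Cell `pub/bsd-wall`, seat `bsd-line-edix-p5` g3 (WIDTH-5). TOOL theorems only (no definition, no named fact, no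
`sorry`); nothing is closed or booked; BSD is not proved by any of this.

WHY. The two landed right-end compositions of the F″ programme
(`Cruxes/StarredOptimalManinUnitFiveSeven/Lines/kato-lever-F2-programme.md` §4/§8),
`StarredOptimalManinUnitFiveSevenNIV.kato_neron_of_depletedValueIntegral` (p599800: F″ ⟸ hlev + NIV) and the three
sockets of `KatoAssemblySocket` (p600780: F″ ⟸ hlev + H, F″ ⟸ hlev + H′), carry the displayed hypothesis
`hlev : ∀ {N} [NeZero N], IsNewformOf.level_eq_conductorNorm (N := N)` — Carayol 1986, a cite-only named fact of the
tree (over the tree it follows from modularity `exists_isNewformOf`, also cite-only). It is used ONLY to read off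
(i) `p ∣ N` and (ii) `a_ℓ(V) = 0` at every `ℓ² ∣ N` for the level `N` of the newform `f` of `V` (F″ quantifies over an
arbitrary level carrying `IsNewformOf V f`). Both are decided by the Fourier coefficients alone and are ALREADY
THEOREMS of the tree (`Literature/NumberTheory/EllipticCurves/CuspFormLFunctionLevelConductorProofs.lean`):
(i) `IsNewformOf.dvd_level_iff_dvd_conductorNorm` — `p ∣ N ↔ p ∣ N_V` (compare `a_{p²} = a_p² − 𝟙·p` on both
sides, Diamond–Shurman Prop. 5.8.5 / (8.44)) — with `p² ∣ N_V` at an additive `p`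
(`sq_dvd_conductorNorm_of_not_good_of_not_mult`); (ii) `IsNewform0.cuspCoeff_eq_zero_of_sq_dvd` — `ℓ² ∣ N ⇒
a_ℓ(f) = 0` on the new subspace (Atkin–Lehner 1970, Thm. 3, from the tree's kernel form of Knapp's Lemma 9.26) —
with `a_ℓ(f) = a_ℓ(V)` (`IsNewformOf`). So `hlev` is REMOVABLE: this file re-states the four right-end theorems
WITHOUT it. Net effect on the programme: once P1 (Kato (8.1.3) + 9.7 + 6.6 (1) + 13.6 in a Néron coordinate,
cite-only) and P4-coh land, the assembled proof of F″ reads **F″ ⟸ {P1, (S5b-tower)}** — neither Carayol's theorem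
nor the modularity theorem is in its cone (the programme map's promise «F″ ⟸ P1 ⊕ (S5b) ⊕ provable glue»).

WHAT IS PROVED (all compositions of landed theorems; H, H′, NIV are DISPLAYED HYPOTHESES with the binder lists of
p599800 / p600780 VERBATIM).
* §1 `dvd_level_of_isNewformOf_of_not_good_of_not_mult` — `IsNewformOf V f` at level `N`, `V` additive at `p` ⟹
  `p ∣ N`; `lFunction_eq_zero_of_sq_dvd_level` — `IsNewformOf V f`, `ℓ` prime, `ℓ² ∣ N` ⟹ `a_ℓ(V) = 0`;
  `forall_lFunction_eq_zero_of_sq_dvd_level` (the `hsq` binder of the value exit).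
* §2 ★ `kato_neron_of_depletedValueIntegral'` — **F″ ⟸ NIV** (no hlev).
* §3 ★ `kato_neron_five_le_of_memberValueLaw'` — **F″ ⟸ H** (no hlev); `kato_neron_five_le_of_valueLaw'` (`W = V`);
  ★ `kato_neron_five_le_of_memberCharSumLaw'` — **F″ ⟸ H′** (no hlev; P4-core composed in), the socket the final
  assembly `P1 ∘ P4-coh ∘ receptacle ⟹ H′` plugs into. K★ then by
  `exact starredOptimalManinUnitFiveSeven_of_kato (kato_neron_five_le_of_memberCharSumLaw' H′)` (p581141; not
  stated here — that closer imports the route file and this helper stays route-independent).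

References: [AtkinLehner1970] Thm. 3; [DiamondShurman2005] Prop. 5.8.5, (8.44); [Kato2004Asterisque] (8.1.3)
p. 180, Thm. 9.7 p. 189, Thm. 6.6 (1) p. 163, Thm. 13.6 p. 227; [KimNakamura2020] Cor. 2.4;
[MazurTateTeitelbaum1986] §I.8 (8.6); programme map §4/§8; `Cruxes/ManinFrameResidueProper/P4-ROADMAP-manin-p1-g8.md`
§1/§3.
-/

set_option autoImplicit false
-- the Theorems namespace of a single-conjunct summit repeats the summit name by design (D-0017)
set_option linter.dupNamespace false

noncomputable section

open scoped MatrixGroups ModularForm Classical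
open Complex CongruenceSubgroup WeierstrassCurve
open Literature.NumberTheory.EllipticCurves Literature.NumberTheory.EllipticCurves.ModularForms
open Literature.NumberTheory.EllipticCurves.Kato2004
open Summit.BirchSwinnertonDyer.BirchSwinnertonDyer.Theorems.StarredOptimalManinUnitFiveSevenValueExit
open Summit.BirchSwinnertonDyer.BirchSwinnertonDyer.Theorems.StarredOptimalManinUnitFiveSevenNIV
open Summit.BirchSwinnertonDyer.BirchSwinnertonDyer.Theorems.KatoNeronIsogenyTransport
open Summit.BirchSwinnertonDyer.BirchSwinnertonDyer.Theorems.KatoAssemblySocket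
open Summit.BirchSwinnertonDyer.BirchSwinnertonDyer.Theorems.SemiLocalDescent
open scoped NumberField
open IsDedekindDomain

namespace Summit.BirchSwinnertonDyer.BirchSwinnertonDyer.Theorems.KatoCarayolFree

/-! ## §1 The two level facts the value exit needs, from the Fourier coefficients alone (no Carayol) -/

/-- **`p ∣ N` for the level `N` of the newform of a curve additive at `p`** — from `IsNewformOf V f` alone:
`p² ∣ N_V` (additive reduction, `sq_dvd_conductorNorm_of_not_good_of_not_mult`) and `p ∣ N ↔ p ∣ N_V`
(`IsNewformOf.dvd_level_iff_dvd_conductorNorm`, the `a_{p²}`-comparison). No input from Carayol's theorem or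
from modularity. [cite: DiamondShurman2005, Prop. 5.8.5 and (8.44)] -/
theorem dvd_level_of_isNewformOf_of_not_good_of_not_mult (V : WeierstrassCurve ℚ) [V.IsElliptic] {N : ℕ}
    [NeZero N] {f : CuspForm (Gamma0 N) 2} (hf : IsNewformOf V f) {p : ℕ} [Fact p.Prime]
    (hng : ¬ V.HasGoodReductionAtPrime p) (hnm : ¬ V.HasMultiplicativeReductionAtPrime p) : p ∣ N :=
  (hf.dvd_level_iff_dvd_conductorNorm (Fact.out : p.Prime)).mpr
    ((dvd_pow_self p two_ne_zero).trans (sq_dvd_conductorNorm_of_not_good_of_not_mult ⟨hng, hnm⟩))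

/-- **`ℓ² ∣ N ⟹ a_ℓ(V) = 0`** for the level `N` of the newform `f` of `V` and a prime `ℓ` — from `IsNewformOf V f`
alone: `a_ℓ(f) = 0` on the new subspace when `ℓ² ∣ N` (Atkin–Lehner 1970, Thm. 3;
`IsNewform0.cuspCoeff_eq_zero_of_sq_dvd`) and `a_ℓ(f) = a_ℓ(V)`. No input from Carayol's theorem.
[cite: AtkinLehner1970, Thm. 3] -/
theorem lFunction_eq_zero_of_sq_dvd_level (V : WeierstrassCurve ℚ) {N : ℕ} [NeZero N]
    {f : CuspForm (Gamma0 N) 2} (hf : IsNewformOf V f) {q : ℕ} (hq : q.Prime) (hq2 : q ^ 2 ∣ N) :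
    V.LFunction q = 0 := by
  have h0 := hf.1.cuspCoeff_eq_zero_of_sq_dvd hq hq2
  rw [hf.2 q] at h0
  exact_mod_cast h0

/-- The `hsq` binder of the value exit, from `IsNewformOf V f` alone: `a_ℓ(V) = 0` at every prime factor `ℓ` of
the level with `ℓ² ∣ N`. [cite: AtkinLehner1970, Thm. 3] -/
theorem forall_lFunction_eq_zero_of_sq_dvd_level (V : WeierstrassCurve ℚ) {N : ℕ} [NeZero N]
    {f : CuspForm (Gamma0 N) 2} (hf : IsNewformOf V f) :
    ∀ q ∈ N.primeFactors, q ^ 2 ∣ N → V.LFunction q = 0 := fun _ hq hq2 ↦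
  lFunction_eq_zero_of_sq_dvd_level V hf (Nat.prime_of_mem_primeFactors hq) hq2

/-! ## §2 F″ ⟸ NIV, Carayol-free -/

/-- ★ **F″ ⟸ NIV (no «level = conductor» hypothesis).** Kato's Néron-twisted integrality at an additive `p ≥ 5`
(`kato_neron_isIntegral_twistedSymbolSum_of_additive_five_le`, the crux's one stub) follows from the NÉRON
`p`-INTEGRALITY OF THE `(m·pN)`-DEPLETED TWISTED CRITICAL VALUES of `χ̄` under F″'s own binders (displayed
hypothesis `hNIV`, parity-split, verbatim the `hNIV` of `kato_neron_of_depletedValueIntegral`) — the value exit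
`katoNeron_{even,odd}_of_depletedValue` at the entire continuation of the inflated series, with `p ∣ N` and
`a_ℓ = 0` at `ℓ² ∣ N` now read off the FOURIER COEFFICIENTS (§1) instead of Carayol's theorem.
[cite: Kato2004Asterisque, (8.1.3) (p. 180), Thm. 9.7 (p. 189), Thm. 6.6 (1) (p. 163)]
[cite: KimNakamura2020, Cor. 2.4] [cite: AtkinLehner1970, Thm. 3] [cite: MazurTateTeitelbaum1986, §I.8 (8.6)] -/
theorem kato_neron_of_depletedValueIntegral'
    (hNIV : ∀ (V : WeierstrassCurve ℚ) [V.IsElliptic] [V.IsGloballyMinimal] {N : ℕ} [NeZero N]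
      (f : CuspForm (Gamma0 N) 2) (_ : IsNewformOf V f) (p : ℕ) [Fact p.Prime] (_ : 5 ≤ p)
      (_ : ¬ V.HasGoodReductionAtPrime p) (_ : ¬ V.HasMultiplicativeReductionAtPrime p)
      (_ : V.HasIrreducibleModPGaloisRep p) (m : ℕ) [NeZero m] (_ : m.Coprime (p * N))
      (_ : 7 < p ∨ (Nat.Coprime (orderOf (p : ZMod m)) (p - 1) ∧
        ∀ P : (V.baseChange ℚ_[p]).toAffine.Point, p • P = 0 → P = 0))
      (χ : DirichletCharacter ℂ m) (_ : χ.IsPrimitive) (_ : χ ≠ 1) (_ : ¬ p ∣ orderOf χ)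
      (L : ℂ → ℂ) (_ : EulerSystemValues.IsDepletedTwistedL f m (p * N) χ⁻¹ L),
      (χ.Even → ∃ s : ℕ, ¬ p ∣ s ∧ IsIntegral ℤ ((s : ℂ) * (L 1 / (V.realPeriodRat : ℂ)))) ∧
      (χ.Odd → ∃ s : ℕ, ¬ p ∣ s ∧ IsIntegral ℤ ((s : ℂ) * (L 1 / (Complex.I * (V.imaginaryPeriodRat : ℂ)))))) :
    kato_neron_isIntegral_twistedSymbolSum_of_additive_five_le := by
  intro V _ _ N _ f hf p _ h5 hng hnm hirr m _ hm hKP χ hχ hχ1 hord ϖ r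
  -- `p ∣ N` and `a_ℓ(V) = 0` at every `ℓ² ∣ N`, from the Fourier coefficients
  have hpN : p ∣ N := dvd_level_of_isNewformOf_of_not_good_of_not_mult V hf hng hnm
  have hsq := forall_lFunction_eq_zero_of_sq_dvd_level V hf
  -- the entire continuation of the `(m·pN)`-inflated series of `χ̄`
  haveI : NeZero (m * (p * N)) :=
    ⟨mul_ne_zero (NeZero.ne m) (mul_ne_zero (Fact.out : p.Prime).ne_zero (NeZero.ne N))⟩
  obtain ⟨L, hLd, hLs⟩ := exists_differentiable_eq_twistedLSeries_holds f
    (DirichletCharacter.changeLevel (dvd_mul_right m (p * N)) χ⁻¹)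
  have hL : EulerSystemValues.IsDepletedTwistedL f m (p * N) χ⁻¹ L := ⟨hLd, hLs⟩
  obtain ⟨heven, hodd⟩ := hNIV V f hf p h5 hng hnm hirr m hm hKP χ hχ hχ1 hord L hL
  refine ⟨fun hev hϖ hr ↦ ?_, fun hod hϖ hr ↦ ?_⟩
  · exact katoNeron_even_of_depletedValue V hf hpN hsq hm hχ hL (heven hev) hϖ hr
  · exact katoNeron_odd_of_depletedValue V hf hpN hsq hm hχ hL (hodd hod) hϖ hr

/-! ## §3 The assembly sockets, Carayol-free -/

/-- ★ **THE ASSEMBLY SOCKET, Carayol-free: F″ ⟸ a Néron value law with `p`-integral character sum at one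
globally minimal member of each class** — `KatoAssemblySocket.kato_neron_five_le_of_memberValueLaw` with its
hypothesis `hlev` REMOVED (binder list of `H` verbatim). Proof: P6 socket
`kato_neron_five_le_of_forall_exists_member'` ∘ value exit `katoNeron_{even,odd}_of_depletedValue` at the member
(`p ∣ N`, `a_ℓ(W) = 0` at `ℓ² ∣ N` from §1 applied to `IsNewformOf W f`) ∘ division
`depletedValueIntegral_of_memberValueLaw`.
[cite: Kato2004Asterisque, (8.1.3) (p. 180), Thm. 9.7 (p. 189), Thm. 6.6 (1) (p. 163), Thm. 13.6 (p. 227)]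
[cite: KimNakamura2020, Cor. 2.4] [cite: AtkinLehner1970, Thm. 3] [cite: MazurTateTeitelbaum1986, §I.8 (8.6)] -/
theorem kato_neron_five_le_of_memberValueLaw'
    (H : ∀ (V : WeierstrassCurve ℚ) [V.IsElliptic] [V.IsGloballyMinimal] {N : ℕ} [NeZero N]
      (f : CuspForm (Gamma0 N) 2), IsNewformOf V f → ∀ (p : ℕ) [Fact p.Prime], 5 ≤ p →
      ¬ V.HasGoodReductionAtPrime p → ¬ V.HasMultiplicativeReductionAtPrime p →
      V.HasIrreducibleModPGaloisRep p → ∀ (m : ℕ) [NeZero m], m.Coprime (p * N) →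
      (7 < p ∨ (Nat.Coprime (orderOf (p : ZMod m)) (p - 1) ∧
        ∀ P : (V.baseChange ℚ_[p]).toAffine.Point, p • P = 0 → P = 0)) →
      ∀ (χ : DirichletCharacter ℂ m), χ.IsPrimitive → χ ≠ 1 → ¬ p ∣ orderOf χ →
      ∃ (W : WeierstrassCurve ℚ) (_ : W.IsElliptic) (_ : W.IsGloballyMinimal), IsIsogenous V W ∧
        (IsNewformOf W f → ¬ W.HasGoodReductionAtPrime p → ¬ W.HasMultiplicativeReductionAtPrime p →
          W.HasIrreducibleModPGaloisRep p →
          (7 < p ∨ (Nat.Coprime (orderOf (p : ZMod m)) (p - 1) ∧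
            ∀ P : (W.baseChange ℚ_[p]).toAffine.Point, p • P = 0 → P = 0)) →
        ∀ (L : ℂ → ℂ), EulerSystemValues.IsDepletedTwistedL f m (p * N) χ⁻¹ L →
        ∀ c d : ℕ,
        (1 < c ∧ c ≡ 1 [MOD N] ∧ c ≡ 1 [MOD p] ∧ (p : ℤ) ∣ (c : ℤ) - 1 ∧ c.Coprime (6 * (m * (p * N))) ∧
          IsUnit (c : ZMod m) ∧ χ (c : ZMod m) ≠ 1) →
        (1 < d ∧ d ≡ 1 [MOD N] ∧ d ≡ 1 [MOD p] ∧ (p : ℤ) ∣ (d : ℤ) - 1 ∧ d.Coprime (6 * (m * (p * N))) ∧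
          IsUnit (d : ZMod m) ∧ χ (d : ZMod m) ≠ 1) →
        ∃ (q : ℚ) (y μ ν : ℂ), ¬ (p : ℤ) ∣ q.num ∧ (∃ s : ℕ, ¬ p ∣ s ∧ IsIntegral ℤ ((s : ℂ) * y)) ∧
          (μ = χ (c : ZMod m) ∨ μ = χ⁻¹ (c : ZMod m)) ∧ (ν = χ (d : ZMod m) ∨ ν = χ⁻¹ (d : ZMod m)) ∧
          (χ.Even → y = ((c : ℂ) ^ 2 - (c : ℂ) * μ) * ((d : ℂ) ^ 2 - (d : ℂ) * ν) * (q : ℂ) *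
            (L 1 / (W.realPeriodRat : ℂ))) ∧
          (χ.Odd → y = ((c : ℂ) ^ 2 - (c : ℂ) * μ) * ((d : ℂ) ^ 2 - (d : ℂ) * ν) * (q : ℂ) *
            (L 1 / (Complex.I * (W.imaginaryPeriodRat : ℂ)))))) :
    kato_neron_isIntegral_twistedSymbolSum_of_additive_five_le := by
  refine kato_neron_five_le_of_forall_exists_member'
    fun V _ _ N _ f hf p _ hp5 hgood hmult hirr m _ hm htors χ hχ hχ1 hord ↦ ?_
  obtain ⟨W, hWE, hWM, hiso, hW⟩ := H V f hf p hp5 hgood hmult hirr m hm htors χ hχ hχ1 hord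
  refine ⟨W, hWE, hWM, hiso, fun hfW hgoodW hmultW hirrW htorsW ϖ r ↦ ?_⟩
  have hVL := hW hfW hgoodW hmultW hirrW htorsW
  -- `p ∣ N` and `a_ℓ(W) = 0` at every `ℓ² ∣ N`, from the Fourier coefficients of the newform of `W`
  have hpN : p ∣ N := dvd_level_of_isNewformOf_of_not_good_of_not_mult W hfW hgoodW hmultW
  have hsq := forall_lFunction_eq_zero_of_sq_dvd_level W hfW
  -- the entire continuation of the `(m·pN)`-inflated series of `χ̄`
  haveI : NeZero (m * (p * N)) :=
    ⟨mul_ne_zero (NeZero.ne m) (mul_ne_zero (Fact.out : p.Prime).ne_zero (NeZero.ne N))⟩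
  obtain ⟨L, hLd, hLs⟩ := exists_differentiable_eq_twistedLSeries_holds f
    (DirichletCharacter.changeLevel (dvd_mul_right m (p * N)) χ⁻¹)
  have hL : EulerSystemValues.IsDepletedTwistedL f m (p * N) χ⁻¹ L := ⟨hLd, hLs⟩
  obtain ⟨heven, hodd⟩ := depletedValueIntegral_of_memberValueLaw W f hm χ hχ1 hord hVL L hL
  refine ⟨fun hev hϖ hr ↦ ?_, fun hod hϖ hr ↦ ?_⟩
  · exact katoNeron_even_of_depletedValue W hfW hpN hsq hm hχ hL (heven hev) hϖ hr
  · exact katoNeron_odd_of_depletedValue W hfW hpN hsq hm hχ hL (hodd hod) hϖ hr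

/-- **The Carayol-free socket for a value law stated at EVERY curve** (no member: `W = V`, `V ∼ V` by the
identity isogeny): F″ ⟸ the value law with `p`-integral character sum at `V` itself, under F″'s binders
(`KatoAssemblySocket.kato_neron_five_le_of_valueLaw` without `hlev`).
[cite: Kato2004Asterisque, (8.1.3) (p. 180), Thm. 9.7 (p. 189), Thm. 6.6 (1) (p. 163)] [cite: AtkinLehner1970, Thm. 3] -/
theorem kato_neron_five_le_of_valueLaw'
    (H : ∀ (V : WeierstrassCurve ℚ) [V.IsElliptic] [V.IsGloballyMinimal] {N : ℕ} [NeZero N]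
      (f : CuspForm (Gamma0 N) 2), IsNewformOf V f → ∀ (p : ℕ) [Fact p.Prime], 5 ≤ p →
      ¬ V.HasGoodReductionAtPrime p → ¬ V.HasMultiplicativeReductionAtPrime p →
      V.HasIrreducibleModPGaloisRep p → ∀ (m : ℕ) [NeZero m], m.Coprime (p * N) →
      (7 < p ∨ (Nat.Coprime (orderOf (p : ZMod m)) (p - 1) ∧
        ∀ P : (V.baseChange ℚ_[p]).toAffine.Point, p • P = 0 → P = 0)) →
      ∀ (χ : DirichletCharacter ℂ m), χ.IsPrimitive → χ ≠ 1 → ¬ p ∣ orderOf χ →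
      ∀ (L : ℂ → ℂ), EulerSystemValues.IsDepletedTwistedL f m (p * N) χ⁻¹ L →
      ∀ c d : ℕ,
      (1 < c ∧ c ≡ 1 [MOD N] ∧ c ≡ 1 [MOD p] ∧ (p : ℤ) ∣ (c : ℤ) - 1 ∧ c.Coprime (6 * (m * (p * N))) ∧
        IsUnit (c : ZMod m) ∧ χ (c : ZMod m) ≠ 1) →
      (1 < d ∧ d ≡ 1 [MOD N] ∧ d ≡ 1 [MOD p] ∧ (p : ℤ) ∣ (d : ℤ) - 1 ∧ d.Coprime (6 * (m * (p * N))) ∧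
        IsUnit (d : ZMod m) ∧ χ (d : ZMod m) ≠ 1) →
      ∃ (q : ℚ) (y μ ν : ℂ), ¬ (p : ℤ) ∣ q.num ∧ (∃ s : ℕ, ¬ p ∣ s ∧ IsIntegral ℤ ((s : ℂ) * y)) ∧
        (μ = χ (c : ZMod m) ∨ μ = χ⁻¹ (c : ZMod m)) ∧ (ν = χ (d : ZMod m) ∨ ν = χ⁻¹ (d : ZMod m)) ∧
        (χ.Even → y = ((c : ℂ) ^ 2 - (c : ℂ) * μ) * ((d : ℂ) ^ 2 - (d : ℂ) * ν) * (q : ℂ) *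
          (L 1 / (V.realPeriodRat : ℂ))) ∧
        (χ.Odd → y = ((c : ℂ) ^ 2 - (c : ℂ) * μ) * ((d : ℂ) ^ 2 - (d : ℂ) * ν) * (q : ℂ) *
          (L 1 / (Complex.I * (V.imaginaryPeriodRat : ℂ))))) :
    kato_neron_isIntegral_twistedSymbolSum_of_additive_five_le := by
  refine kato_neron_five_le_of_memberValueLaw'
    fun V _ _ N _ f hf p _ hp5 hgood hmult hirr m _ hm htors χ hχ hχ1 hord ↦ ?_
  exact ⟨V, inferInstance, inferInstance, isIsogenous_self V,
    fun _ _ _ _ _ L hL c d hc hd ↦ H V f hf p hp5 hgood hmult hirr m hm htors χ hχ hχ1 hord L hL c d hc hd⟩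

/-- ★ **THE ASSEMBLY SOCKET in Kato's RATIONAL-VALUE currency, Carayol-free: F″ ⟸ H′**
(`KatoAssemblySocket.kato_neron_five_le_of_memberCharSumLaw` with its hypothesis `hlev` REMOVED; binder list of
`H′` verbatim): for every `V` under F″'s binders, SOME globally minimal `W ∼ V` such that, under `W`'s own copy of
F″'s hypotheses, for every entire continuation `L` of the `(m·pN)`-inflated series of `χ̄` and all `c, d` carrying
the unit-choice conclusions, there are `q ∈ ℚ` with `p ∤ num q`, a character `ψ` mod `m`, an embedding
`ι : ℚ(ζ_m) → ℂ`, Kato's RATIONAL value `x ∈ ℚ(ζ_m)` (Thm. 9.7) INTEGRAL AT EVERY PLACE `w ∣ p` (receptacle ∘ P4-coh),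
`μ ∈ {χ(c), χ⁻¹(c)}`, `ν ∈ {χ(d), χ⁻¹(d)}` and the VALUE LAW `Σ_b ψ(b)·ι(σ_b x) = (c² − cμ)(d² − dν)·q·L(1)/Ω^±(W)`
(Thm. 6.6 (1), case `ξ ∈ SL₂(ℤ)`, in the Néron basis). Proof: P4-core
`exists_not_dvd_isIntegral_charSum_of_forall_valuation_le_one` then `kato_neron_five_le_of_memberValueLaw'`.
After it the assembled F″ reads F″ ⟸ {P1, (S5b-tower)}: no Carayol, no modularity.
[cite: Kato2004Asterisque, (8.1.3) (p. 180), Thm. 9.7 (p. 189), Thm. 6.6 (1) (p. 163), Thm. 13.6 (p. 227)]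
[cite: KimNakamura2020, Cor. 2.4] [cite: AtkinLehner1970, Thm. 3] -/
theorem kato_neron_five_le_of_memberCharSumLaw'
    (H : ∀ (V : WeierstrassCurve ℚ) [V.IsElliptic] [V.IsGloballyMinimal] {N : ℕ} [NeZero N]
      (f : CuspForm (Gamma0 N) 2), IsNewformOf V f → ∀ (p : ℕ) [Fact p.Prime], 5 ≤ p →
      ¬ V.HasGoodReductionAtPrime p → ¬ V.HasMultiplicativeReductionAtPrime p →
      V.HasIrreducibleModPGaloisRep p → ∀ (m : ℕ) [NeZero m], m.Coprime (p * N) →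
      (7 < p ∨ (Nat.Coprime (orderOf (p : ZMod m)) (p - 1) ∧
        ∀ P : (V.baseChange ℚ_[p]).toAffine.Point, p • P = 0 → P = 0)) →
      ∀ (χ : DirichletCharacter ℂ m), χ.IsPrimitive → χ ≠ 1 → ¬ p ∣ orderOf χ →
      ∃ (W : WeierstrassCurve ℚ) (_ : W.IsElliptic) (_ : W.IsGloballyMinimal), IsIsogenous V W ∧
        (IsNewformOf W f → ¬ W.HasGoodReductionAtPrime p → ¬ W.HasMultiplicativeReductionAtPrime p →
          W.HasIrreducibleModPGaloisRep p →
          (7 < p ∨ (Nat.Coprime (orderOf (p : ZMod m)) (p - 1) ∧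
            ∀ P : (W.baseChange ℚ_[p]).toAffine.Point, p • P = 0 → P = 0)) →
        ∀ (L : ℂ → ℂ), EulerSystemValues.IsDepletedTwistedL f m (p * N) χ⁻¹ L →
        ∀ c d : ℕ,
        (1 < c ∧ c ≡ 1 [MOD N] ∧ c ≡ 1 [MOD p] ∧ (p : ℤ) ∣ (c : ℤ) - 1 ∧ c.Coprime (6 * (m * (p * N))) ∧
          IsUnit (c : ZMod m) ∧ χ (c : ZMod m) ≠ 1) →
        (1 < d ∧ d ≡ 1 [MOD N] ∧ d ≡ 1 [MOD p] ∧ (p : ℤ) ∣ (d : ℤ) - 1 ∧ d.Coprime (6 * (m * (p * N))) ∧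
          IsUnit (d : ZMod m) ∧ χ (d : ZMod m) ≠ 1) →
        ∃ (q : ℚ) (ψ : DirichletCharacter ℂ m) (ι : CyclotomicField m ℚ →+* ℂ) (x : CyclotomicField m ℚ)
          (μ ν : ℂ), ¬ (p : ℤ) ∣ q.num ∧
          (∀ w : HeightOneSpectrum (𝓞 (CyclotomicField m ℚ)),
            (p : 𝓞 (CyclotomicField m ℚ)) ∈ w.asIdeal → w.valuation (CyclotomicField m ℚ) x ≤ 1) ∧
          (μ = χ (c : ZMod m) ∨ μ = χ⁻¹ (c : ZMod m)) ∧ (ν = χ (d : ZMod m) ∨ ν = χ⁻¹ (d : ZMod m)) ∧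
          (χ.Even → EulerSystemValues.charSum m ι ψ x =
            ((c : ℂ) ^ 2 - (c : ℂ) * μ) * ((d : ℂ) ^ 2 - (d : ℂ) * ν) * (q : ℂ) *
              (L 1 / (W.realPeriodRat : ℂ))) ∧
          (χ.Odd → EulerSystemValues.charSum m ι ψ x =
            ((c : ℂ) ^ 2 - (c : ℂ) * μ) * ((d : ℂ) ^ 2 - (d : ℂ) * ν) * (q : ℂ) *
              (L 1 / (Complex.I * (W.imaginaryPeriodRat : ℂ)))))) :
    kato_neron_isIntegral_twistedSymbolSum_of_additive_five_le := by
  refine kato_neron_five_le_of_memberValueLaw'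
    fun V _ _ N _ f hf p _ hp5 hgood hmult hirr m _ hm htors χ hχ hχ1 hord ↦ ?_
  obtain ⟨W, hWE, hWM, hiso, hW⟩ := H V f hf p hp5 hgood hmult hirr m hm htors χ hχ hχ1 hord
  refine ⟨W, hWE, hWM, hiso, fun hfW hgoodW hmultW hirrW htorsW L hL c d hc hd ↦ ?_⟩
  obtain ⟨q, ψ, ι, x, μ, ν, hq, hx, hμ, hν, he, ho⟩ :=
    hW hfW hgoodW hmultW hirrW htorsW L hL c d hc hd
  exact ⟨q, EulerSystemValues.charSum m ι ψ x, μ, ν, hq,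
    exists_not_dvd_isIntegral_charSum_of_forall_valuation_le_one m p ι ψ x hx, hμ, hν, he, ho⟩

end Summit.BirchSwinnertonDyer.BirchSwinnertonDyer.Theorems.KatoCarayolFree

end
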